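import Mathlib
import Summits.KontsevichZagierPeriods.Zeta5Search.DenomLaw.LawA4Pal
import HarnessLib

/-!
# ζ(5) search — THEOREM A⁗′ as ONE Boolean guard (`lawA4PalGuard`) with its licence, for per-cell kernel evaluation

Cell `pub-zeta5` (HONEST FRAMING: systematic search; no irrationality claim unless certified), track «DENOM-LAW», seat `denom-prover-d1` gen 10
(ATTEMPT-10).  The five class clauses of THEOREM A⁗′ (`SecondOrder.lawA4Pal`, file `DenomLaw/LawA4Pal.lean`: (H0) for multipole / single-pole classes,
(T1) deep classes of type `T`, (T2) raises or the odd-centre class at `ν = −M+1`, (T3′) double raises OR palindromes at `ν = −M+2`) packed, with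
`6 ≤ M`, `M` even and `T` palindromic, into ONE Boolean `lawA4PalGuard b p M T` (evaluable per cell by `decide` / `#eval`, like the census's `ccGuard`
and prover-d1 g9's `raiseLineGuard`), and the licence `lawA4Pal_of_guard`: `lawA4PalGuard b p M T = true ⇒ 7 − 2M ≤ v_p(Cas_j(b))` in the window.
`p`-adic valuations of the cell's own rationals; nothing about ζ(5); no γ of record moves; records in print UNMOVED.
-/

open Finset

namespace Summit.KontsevichZagierPeriods.Zeta5Search.SecondOrder

open Summit.KontsevichZagierPeriods.Zeta5Search.CasoratianValuation (InPolytope shift casoratian)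
open Summit.KontsevichZagierPeriods.Zeta5Search.ClusterValuation

/-- **A⁗′ GUARD**: `6 ≤ M`, `M` even, `T` a palindrome, and the class clauses (H0), (T1), (T2), (T3′) of `lawA4Pal` for `b` at `p` in the frame `(M, T)`. -/
def lawA4PalGuard (b : ℕ → ℤ) (p M : ℕ) (T : List ℤ) : Bool :=
  decide (6 ≤ M) && (M % 2 == 0) && (T.reverse == T) &&
    decide (∀ x ∈ multipoleClasses b p, -(M : ℤ) ≤ classExp b p x) &&
    decide (∀ y < p, classPoleCount b p y = 1 → -(M : ℤ) + 1 ≤ classNu b p y) &&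
    decide (∀ x ∈ multipoleClasses b p, classExp b p x = -(M : ℤ) → ¬ CentreIn b p x ∧ classTypeList b p x = T) &&
    decide (∀ y < p, 1 ≤ classPoleCount b p y → classNu b p y = -(M : ℤ) + 1 →
      isRaise T (classTypeList b p y) = true ∨ (¬ (2 : ℤ) ∣ b 0 ∧ CentreIn b p y ∧ classTypeList b p y = T)) &&
    decide (∀ z < p, 1 ≤ classPoleCount b p z → classNu b p z = -(M : ℤ) + 2 →
      isRaise2 T (classTypeList b p z) = true ∨ (classTypeList b p z).reverse = classTypeList b p z)

/-- **Licence**: `lawA4PalGuard b p M T = true` gives `7 − 2M ≤ v_p(Cas_j(b))` for every admissible direction `j` in the window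
`5 ≤ p ≤ b₀ < p² − 2` (THEOREM A⁗′ by name). -/
theorem lawA4Pal_of_guard (b : ℕ → ℤ) (p j M : ℕ) (T : List ℤ) (hb : InPolytope b) (hb' : InPolytope (shift b j))
    (hj1 : 1 ≤ j) (hj7 : j ≤ 7) (hprime : p.Prime) (hp5 : 5 ≤ p) (hpb : (p : ℤ) ≤ b 0) (hwin : (b 0 + 2 : ℤ) < (p : ℤ) ^ 2)
    (H : lawA4PalGuard b p M T = true) (hcas : casoratian b j ≠ 0) :
    (7 : ℤ) - 2 * M ≤ padicValRat p (casoratian b j) := by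
  have H' := H
  simp only [lawA4PalGuard, Bool.and_eq_true, decide_eq_true_eq, beq_iff_eq] at H'
  obtain ⟨⟨⟨⟨⟨⟨⟨hM, hMe⟩, hT⟩, h1⟩, h2⟩, h3⟩, h4⟩, h5⟩ := H'
  haveI : Fact p.Prime := ⟨hprime⟩
  exact lawA4Pal b j M T hb hb' ⟨hj1, hj7⟩ hp5 hpb hwin ⟨hM, Nat.even_iff.2 hMe⟩ hT h1
    (fun y hy => h2 y hy) h3 (fun y hy => h4 y hy) (fun z hz => h5 z hz) hcas

/-! ## Sanity: the guard on one residual cell of the R1 per-prime census (ATTEMPT-10 §1): `b = (31; 15,15,10,10,10,10,4)`, `p = 11`,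
frame `M = 8`, `T = [−4,−4]` (deep layer empty; the odd-centre class alone at `ν = −7`; the pair of single sextuple poles `(0,−6,0)` at `ν = −6`). -/

/-- A residual cell of the R1 census at `p = 11` (digit type a=2 N=12). -/
def bResidual : ℕ → ℤ := fun i => (([31, 15, 15, 10, 10, 10, 10, 4] : List ℤ).getD i 0)

example : lawA4PalGuard bResidual 11 8 [-4, -4] = true := by decide

end Summit.KontsevichZagierPeriods.Zeta5Search.SecondOrder
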